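import Literature.NumberTheory.Transcendental.Associators
import Literature.NumberTheory.Transcendental.KZCubicalCalculus
import Literature.NumberTheory.Transcendental.NashCubes
import Literature.NumberTheory.Transcendental.SemialgebraicLineDeriv

/-!
# `PentagonInKZ`, line `edge-normal-newton-leibniz`: corner engine — reverse peeling and semialgebraicity (existence of `Q a`, `E a`, part 2)

Helper file for the proof of `cornerEngine_uniformlyNull` (crux `FurushoPentagon.PentagonInKZ`,
stmt-KontsevichZagierPeriods-11348), in the ABSTRACT ENGINE signature.  Two inputs for the
existence of the level-`(n−2)` terms `E a` of Step A:
* **reverse peeling** (`qe_sum_gd_Bf`): on the open horizontal cube,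
  `β Σ_b gd_b(ξ,η) B^{(μ∘op a)∘opV b}_{k,l}(x, y; ξ, η) = B^{μ∘op a}_{k,l+1}(x, η/β :: y; ξ, β)`,
  from the peeling identity `hpeelV` read backwards and the centrality of `Z_{ℓ'}` against the
  horizontal edge transport (`hcentH`), which moves the transverse insertion `opV b` inside the
  product `wZ V · wZ U`;
* **semialgebraicity** of the transport `B` composed with semialgebraic blocks and roles, of the
  coordinate blocks, and of semialgebraic functions of sub-blocks of the parameters.

References: [Drinfeld1991, §2], [IharaKanekoZagier2006, Cor. 5], [BochnakCosteRoy1998, Prop. 2.2.6].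
-/

noncomputable section

open Set MeasureTheory
open Literature.NumberTheory.Transcendental
open Literature.ModelTheory.ExponentialFields (IsSemialgebraic)

namespace Summit.KontsevichZagierPeriods.FurushoPentagon.PentagonInKZ

section AbstractEngine

variable {m N : ℕ} {ℓ ℓ' : Fin (m + 2)} {α β : ℚ}
  {Zq : Fin (m + 2) → (DrinfeldKohnoTrunc ℚ (Fin 4) N)} {wZ : ∀ {n : ℕ}, (Fin n → Fin (m + 2)) → (DrinfeldKohnoTrunc ℚ (Fin 4) N)}
  {fd gd dd : Fin (m + 2) → ℝ → ℝ → ℝ}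
  {Ht Vt dHt dVt : ∀ {n : ℕ}, (Fin n → Fin (m + 2)) → (Fin n → ℝ) → ℝ → ℝ → ℝ}
  {op opV : Fin (m + 2) → (DrinfeldKohnoTrunc ℚ (Fin 4) N) →ₗ[ℚ] (DrinfeldKohnoTrunc ℚ (Fin 4) N)}
  {Af Bf dAf dBf F : ((DrinfeldKohnoTrunc ℚ (Fin 4) N) →ₗ[ℚ] ℚ) → ∀ {k l : ℕ}, (Fin k → ℝ) → (Fin l → ℝ) → ℝ → ℝ → ℝ}
  {Xb : ∀ k l e : ℕ, (Fin (k + l + e) → ℝ) → Fin k → ℝ}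
  {Yb : ∀ k l e : ℕ, (Fin (k + l + e) → ℝ) → Fin l → ℝ}
  {Θb : ∀ k l e : ℕ, (Fin (k + l + e) → ℝ) → Fin e → ℝ}

variable (H :
    (∀ {n : ℕ} (U : Fin n → Fin (m + 2)), wZ U = ((List.ofFn U).map Zq).prod) ∧
    (∀ (a : Fin (m + 2)) (X : (DrinfeldKohnoTrunc ℚ (Fin 4) N)), op a X = if a = ℓ then Zq ℓ * X - X * Zq ℓ else Zq a * X) ∧
    (∀ (b : Fin (m + 2)) (X : (DrinfeldKohnoTrunc ℚ (Fin 4) N)), opV b X = if b = ℓ' then Zq ℓ' * X - X * Zq ℓ' else Zq b * X) ∧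
    (∀ (μ : (DrinfeldKohnoTrunc ℚ (Fin 4) N) →ₗ[ℚ] ℚ) {k l : ℕ} (x : Fin k → ℝ) (y : Fin l → ℝ) (ξ η : ℝ), Af μ x y ξ η = ∑ U : Fin k → Fin (m + 2), ∑ V : Fin l → Fin (m + 2), (μ (wZ U * wZ V) : ℝ) * (Ht U x ξ η * Vt V y 0 η)) ∧
    (∀ (μ : (DrinfeldKohnoTrunc ℚ (Fin 4) N) →ₗ[ℚ] ℚ) {k l : ℕ} (x : Fin k → ℝ) (y : Fin l → ℝ) (ξ η : ℝ), Bf μ x y ξ η = ∑ U : Fin k → Fin (m + 2), ∑ V : Fin l → Fin (m + 2), (μ (wZ V * wZ U) : ℝ) * (Vt V y ξ η * Ht U x ξ 0)) ∧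
    (∀ (μ : (DrinfeldKohnoTrunc ℚ (Fin 4) N) →ₗ[ℚ] ℚ) {k l : ℕ} (x : Fin k → ℝ) (y : Fin l → ℝ) (ξ η : ℝ), dAf μ x y ξ η = ∑ U : Fin k → Fin (m + 2), ∑ V : Fin l → Fin (m + 2), (μ (wZ U * wZ V) : ℝ) * (dHt U x ξ η * Vt V y 0 η)) ∧
    (∀ (μ : (DrinfeldKohnoTrunc ℚ (Fin 4) N) →ₗ[ℚ] ℚ) {k l : ℕ} (x : Fin k → ℝ) (y : Fin l → ℝ) (ξ η : ℝ), dBf μ x y ξ η = ∑ U : Fin k → Fin (m + 2), ∑ V : Fin l → Fin (m + 2), (μ (wZ V * wZ U) : ℝ) * (dVt V y ξ η * Ht U x ξ 0)) ∧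
    (∀ (μ : (DrinfeldKohnoTrunc ℚ (Fin 4) N) →ₗ[ℚ] ℚ) {k l : ℕ} (x : Fin k → ℝ) (y : Fin l → ℝ) (ξ η : ℝ), F μ x y ξ η = Af μ x y ξ η - Bf μ x y ξ η) ∧
    (∀ (k l e : ℕ) (z : Fin (k + l + e) → ℝ), Xb k l e z = fun i => z (Fin.castAdd e (Fin.castAdd l i))) ∧
    (∀ (k l e : ℕ) (z : Fin (k + l + e) → ℝ), Yb k l e z = fun j => z (Fin.castAdd e (Fin.natAdd k j))) ∧
    (∀ (k l e : ℕ) (z : Fin (k + l + e) → ℝ), Θb k l e z = fun s => z (Fin.natAdd (k + l) s)) ∧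
    (∀ (U : Fin 0 → Fin (m + 2)) (x : Fin 0 → ℝ) (ξ η : ℝ), Ht U x ξ η = 1) ∧
    (∀ (V : Fin 0 → Fin (m + 2)) (y : Fin 0 → ℝ) (ξ η : ℝ), Vt V y ξ η = 1) ∧
    (∀ (U : Fin 0 → Fin (m + 2)) (x : Fin 0 → ℝ) (ξ η : ℝ), dHt U x ξ η = 0) ∧
    (∀ (V : Fin 0 → Fin (m + 2)) (y : Fin 0 → ℝ) (ξ η : ℝ), dVt V y ξ η = 0) ∧
    (∀ {k : ℕ} (U : Fin (k + 1) → Fin (m + 2)) (x : Fin (k + 1) → ℝ) (η : ℝ), Ht U x 0 η = 0) ∧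
    (∀ {l : ℕ} (V : Fin (l + 1) → Fin (m + 2)) (y : Fin (l + 1) → ℝ) (ξ : ℝ), Vt V y ξ 0 = 0) ∧
    (∀ t y : ℝ, fd ℓ t y = 1 / t) ∧
    (∀ x s : ℝ, gd ℓ' x s = 1 / s) ∧
    (∀ x y : ℝ, dd ℓ x y = 0) ∧
    (∀ x y : ℝ, dd ℓ' x y = 0) ∧
    (∀ (μ : (DrinfeldKohnoTrunc ℚ (Fin 4) N) →ₗ[ℚ] ℚ) {k : ℕ} (x₀ : ℝ) (x' : Fin k → ℝ) (ξ η : ℝ), ∑ U : Fin (k + 1) → Fin (m + 2), (μ (wZ U) : ℝ) * Ht U (Fin.cons x₀ x') ξ η = (∑ a : Fin (m + 2), (if a = ℓ then 1 / x₀ else ξ * fd a (ξ * x₀) η) * ∑ U' : Fin k → Fin (m + 2), (μ (Zq a * wZ U') : ℝ) * Ht U' x' (ξ * x₀) η) - (1 / x₀) * ∑ U' : Fin k → Fin (m + 2), (μ (wZ U' * Zq ℓ) : ℝ) * Ht U' x' (ξ * x₀) η) ∧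
    (∀ (μ : (DrinfeldKohnoTrunc ℚ (Fin 4) N) →ₗ[ℚ] ℚ) {l : ℕ} (y₀ : ℝ) (y' : Fin l → ℝ) (ξ η : ℝ), ∑ V : Fin (l + 1) → Fin (m + 2), (μ (wZ V) : ℝ) * Vt V (Fin.cons y₀ y') ξ η = (∑ b : Fin (m + 2), (if b = ℓ' then 1 / y₀ else η * gd b ξ (η * y₀)) * ∑ V' : Fin l → Fin (m + 2), (μ (Zq b * wZ V') : ℝ) * Vt V' y' ξ (η * y₀)) - (1 / y₀) * ∑ V' : Fin l → Fin (m + 2), (μ (wZ V' * Zq ℓ') : ℝ) * Vt V' y' ξ (η * y₀)) ∧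
    (∀ (μ : (DrinfeldKohnoTrunc ℚ (Fin 4) N) →ₗ[ℚ] ℚ) {l : ℕ} (P Q : (DrinfeldKohnoTrunc ℚ (Fin 4) N)) (y : Fin l → ℝ) (η : ℝ), (∀ i, 0 < y i ∧ y i < 1) → 0 < η → η ≤ (β : ℝ) → ∑ V : Fin l → Fin (m + 2), (μ (P * (Zq ℓ * wZ V - wZ V * Zq ℓ) * Q) : ℝ) * Vt V y 0 η = 0) ∧
    (∀ (μ : (DrinfeldKohnoTrunc ℚ (Fin 4) N) →ₗ[ℚ] ℚ) {k : ℕ} (P Q : (DrinfeldKohnoTrunc ℚ (Fin 4) N)) (x : Fin k → ℝ) (ξ : ℝ), (∀ i, 0 < x i ∧ x i < 1) → 0 < ξ → ξ ≤ (α : ℝ) → ∑ U : Fin k → Fin (m + 2), (μ (P * (Zq ℓ' * wZ U - wZ U * Zq ℓ') * Q) : ℝ) * Ht U x ξ 0 = 0) ∧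
    (∀ (μ : (DrinfeldKohnoTrunc ℚ (Fin 4) N) →ₗ[ℚ] ℚ) (P Q : (DrinfeldKohnoTrunc ℚ (Fin 4) N)), μ (P * (Zq ℓ * Zq ℓ' - Zq ℓ' * Zq ℓ) * Q) = 0) ∧
    (∀ (μ : (DrinfeldKohnoTrunc ℚ (Fin 4) N) →ₗ[ℚ] ℚ) (P Q : (DrinfeldKohnoTrunc ℚ (Fin 4) N)) (x y : ℝ), 0 < x → x < (α : ℝ) → 0 < y → y < (β : ℝ) → ∑ a : Fin (m + 2), ∑ b : Fin (m + 2), (fd a x y * gd b x y) * (μ (P * (Zq a * Zq b - Zq b * Zq a) * Q) : ℝ) = 0) ∧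
    (∀ (μ : (DrinfeldKohnoTrunc ℚ (Fin 4) N) →ₗ[ℚ] ℚ) (P Q : (DrinfeldKohnoTrunc ℚ (Fin 4) N)) (s : ℝ), 0 < s → s < (β : ℝ) → ∑ b : Fin (m + 2), gd b 0 s * (μ (P * (Zq ℓ * Zq b - Zq b * Zq ℓ) * Q) : ℝ) = 0) ∧
    (∀ (μ : (DrinfeldKohnoTrunc ℚ (Fin 4) N) →ₗ[ℚ] ℚ) (P Q : (DrinfeldKohnoTrunc ℚ (Fin 4) N)) (t : ℝ), 0 < t → t < (α : ℝ) → ∑ a : Fin (m + 2), fd a t 0 * (μ (P * (Zq ℓ' * Zq a - Zq a * Zq ℓ') * Q) : ℝ) = 0) ∧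
    (∀ (a : Fin (m + 2)) (ξ η : ℝ), 0 ≤ ξ → ξ ≤ (α : ℝ) → 0 ≤ η → η ≤ (β : ℝ) → HasDerivAt (fun y => fd a ξ y) (dd a ξ η) η) ∧
    (∀ (b : Fin (m + 2)) (ξ η : ℝ), 0 ≤ ξ → ξ ≤ (α : ℝ) → 0 ≤ η → η ≤ (β : ℝ) → HasDerivAt (fun x => gd b x η) (dd b ξ η) ξ) ∧
    (∀ {k : ℕ} (U : Fin k → Fin (m + 2)) (x : Fin k → ℝ) (ξ η : ℝ), (∀ i, 0 ≤ x i ∧ x i ≤ 1) → 0 ≤ ξ → ξ ≤ (α : ℝ) → 0 ≤ η → η ≤ (β : ℝ) → HasDerivAt (fun t => Ht U x t η) (dHt U x ξ η) ξ) ∧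
    (∀ {l : ℕ} (V : Fin l → Fin (m + 2)) (y : Fin l → ℝ) (ξ η : ℝ), (∀ i, 0 ≤ y i ∧ y i ≤ 1) → 0 ≤ ξ → ξ ≤ (α : ℝ) → 0 ≤ η → η ≤ (β : ℝ) → HasDerivAt (fun s => Vt V y ξ s) (dVt V y ξ η) η) ∧
    (∀ {k : ℕ} (U : Fin (k + 1) → Fin (m + 2)) (x₀ : ℝ) (x' : Fin k → ℝ) (ξ η : ℝ), 0 < x₀ → x₀ < 1 → (∀ i, 0 ≤ x' i ∧ x' i ≤ 1) → 0 ≤ ξ → ξ ≤ (α : ℝ) → 0 ≤ η → η ≤ (β : ℝ) → HasDerivAt (fun t => t * Ht U (Fin.cons t x') ξ η) (ξ * dHt U (Fin.cons x₀ x') ξ η) x₀) ∧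
    (∀ {l : ℕ} (V : Fin (l + 1) → Fin (m + 2)) (y₀ : ℝ) (y' : Fin l → ℝ) (ξ η : ℝ), 0 < y₀ → y₀ < 1 → (∀ i, 0 ≤ y' i ∧ y' i ≤ 1) → 0 ≤ ξ → ξ ≤ (α : ℝ) → 0 ≤ η → η ≤ (β : ℝ) → HasDerivAt (fun t => t * Vt V (Fin.cons t y') ξ η) (η * dVt V (Fin.cons y₀ y') ξ η) y₀) ∧
    (∀ {k : ℕ} (U : Fin (k + 1) → Fin (m + 2)) (x' : Fin k → ℝ) (ξ η : ℝ), (∀ i, 0 ≤ x' i ∧ x' i ≤ 1) → 0 ≤ ξ → ξ ≤ (α : ℝ) → 0 ≤ η → η ≤ (β : ℝ) → ContinuousOn (fun t => t * Ht U (Fin.cons t x') ξ η) (Set.Icc 0 1)) ∧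
    (∀ {l : ℕ} (V : Fin (l + 1) → Fin (m + 2)) (y' : Fin l → ℝ) (ξ η : ℝ), (∀ i, 0 ≤ y' i ∧ y' i ≤ 1) → 0 ≤ ξ → ξ ≤ (α : ℝ) → 0 ≤ η → η ≤ (β : ℝ) → ContinuousOn (fun t => t * Vt V (Fin.cons t y') ξ η) (Set.Icc 0 1)) ∧
    (∀ {d : ℕ} {W : Set (Fin d → ℝ)}, IsSemialgebraic ℚ W → ∀ (a : Fin (m + 2)) {T Y : (Fin d → ℝ) → ℝ}, IsSemialgebraicFunOn ℚ W T → IsSemialgebraicFunOn ℚ W Y → IsSemialgebraicFunOn ℚ W fun z => fd a (T z) (Y z)) ∧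
    (∀ {d : ℕ} {W : Set (Fin d → ℝ)}, IsSemialgebraic ℚ W → ∀ (b : Fin (m + 2)) {T Y : (Fin d → ℝ) → ℝ}, IsSemialgebraicFunOn ℚ W T → IsSemialgebraicFunOn ℚ W Y → IsSemialgebraicFunOn ℚ W fun z => gd b (T z) (Y z)) ∧
    (∀ {d : ℕ} {W : Set (Fin d → ℝ)}, IsSemialgebraic ℚ W → ∀ (a : Fin (m + 2)) {T Y : (Fin d → ℝ) → ℝ}, IsSemialgebraicFunOn ℚ W T → IsSemialgebraicFunOn ℚ W Y → IsSemialgebraicFunOn ℚ W fun z => dd a (T z) (Y z)) ∧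
    (∀ {d : ℕ} {W : Set (Fin d → ℝ)}, IsSemialgebraic ℚ W → ∀ {n : ℕ} (U : Fin n → Fin (m + 2)) {X : (Fin d → ℝ) → Fin n → ℝ} {P Q : (Fin d → ℝ) → ℝ}, (∀ i, IsSemialgebraicFunOn ℚ W fun z => X z i) → IsSemialgebraicFunOn ℚ W P → IsSemialgebraicFunOn ℚ W Q → IsSemialgebraicFunOn ℚ W fun z => Ht U (X z) (P z) (Q z)) ∧
    (∀ {d : ℕ} {W : Set (Fin d → ℝ)}, IsSemialgebraic ℚ W → ∀ {n : ℕ} (V : Fin n → Fin (m + 2)) {Y : (Fin d → ℝ) → Fin n → ℝ} {P Q : (Fin d → ℝ) → ℝ}, (∀ i, IsSemialgebraicFunOn ℚ W fun z => Y z i) → IsSemialgebraicFunOn ℚ W P → IsSemialgebraicFunOn ℚ W Q → IsSemialgebraicFunOn ℚ W fun z => Vt V (Y z) (P z) (Q z)) ∧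
    (∀ {d : ℕ} {W : Set (Fin d → ℝ)}, IsSemialgebraic ℚ W → ∀ {n : ℕ} (U : Fin n → Fin (m + 2)) {X : (Fin d → ℝ) → Fin n → ℝ} {P Q : (Fin d → ℝ) → ℝ}, (∀ i, IsSemialgebraicFunOn ℚ W fun z => X z i) → IsSemialgebraicFunOn ℚ W P → IsSemialgebraicFunOn ℚ W Q → IsSemialgebraicFunOn ℚ W fun z => dHt U (X z) (P z) (Q z)) ∧
    (∀ {d : ℕ} {W : Set (Fin d → ℝ)}, IsSemialgebraic ℚ W → ∀ {n : ℕ} (V : Fin n → Fin (m + 2)) {Y : (Fin d → ℝ) → Fin n → ℝ} {P Q : (Fin d → ℝ) → ℝ}, (∀ i, IsSemialgebraicFunOn ℚ W fun z => Y z i) → IsSemialgebraicFunOn ℚ W P → IsSemialgebraicFunOn ℚ W Q → IsSemialgebraicFunOn ℚ W fun z => dVt V (Y z) (P z) (Q z)) ∧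
    (∃ C : ℝ, ∀ (a : Fin (m + 2)) (ξ η : ℝ), 0 ≤ ξ → ξ ≤ (α : ℝ) → 0 ≤ η → η ≤ (β : ℝ) → (a ≠ ℓ → |fd a ξ η| ≤ C) ∧ (a ≠ ℓ' → |gd a ξ η| ≤ C) ∧ |dd a ξ η| ≤ C ∧ (∀ η' : ℝ, 0 ≤ η' → η' ≤ (β : ℝ) → |fd a ξ η - fd a ξ η'| ≤ C * |η - η'|) ∧ (∀ ξ' : ℝ, 0 ≤ ξ' → ξ' ≤ (α : ℝ) → |gd a ξ η - gd a ξ' η| ≤ C * |ξ - ξ'|)) ∧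
    (∀ k : ℕ, ∃ C : ℝ, ∀ (U : Fin k → Fin (m + 2)) (x : Fin k → ℝ) (ξ η : ℝ), (∀ i, 0 ≤ x i ∧ x i ≤ 1) → 0 ≤ ξ → ξ ≤ (α : ℝ) → 0 ≤ η → η ≤ (β : ℝ) → |Ht U x ξ η| ≤ C ∧ |dHt U x ξ η| ≤ C ∧ (0 < k → |Ht U x ξ η| ≤ C * ξ) ∧ (∀ η' : ℝ, 0 ≤ η' → η' ≤ (β : ℝ) → |Ht U x ξ η - Ht U x ξ η'| ≤ C * ξ * |η - η'|)) ∧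
    (∀ l : ℕ, ∃ C : ℝ, ∀ (V : Fin l → Fin (m + 2)) (y : Fin l → ℝ) (ξ η : ℝ), (∀ i, 0 ≤ y i ∧ y i ≤ 1) → 0 ≤ ξ → ξ ≤ (α : ℝ) → 0 ≤ η → η ≤ (β : ℝ) → |Vt V y ξ η| ≤ C ∧ |dVt V y ξ η| ≤ C ∧ (0 < l → |Vt V y ξ η| ≤ C * η) ∧ (∀ ξ' : ℝ, 0 ≤ ξ' → ξ' ≤ (α : ℝ) → |Vt V y ξ η - Vt V y ξ' η| ≤ C * η * |ξ - ξ'|)))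

/-! ### Reverse peeling of the level-`(n−2)` sum (worker QE) -/

include H in
/-- **Moving the transverse insertion inside the product** on the open horizontal cube:
`Σ_{U,V} μ(op_a(opV_b(wZ V · wZ U))) Vt_V Ht_U = Σ_{U,V} μ(op_a(opV_b(wZ V) · wZ U)) Vt_V Ht_U`
for `0 < ξ ≤ α` (for `b = ℓ'` the difference is `Σ_V Vt_V · Σ_U μ(op_a(wZ V [Z_{ℓ'}, wZ U])) Ht_U(ξ,0)`,
killed by the centrality of `Z_{ℓ'}` against the horizontal edge transport). [cite: Drinfeld1991, §2] -/
theorem qe_opV_inside (μ : (DrinfeldKohnoTrunc ℚ (Fin 4) N) →ₗ[ℚ] ℚ) {k l : ℕ} (a b : Fin (m + 2))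
    (x : Fin k → ℝ) (y : Fin l → ℝ) (ξ η : ℝ) (hx : ∀ i, 0 < x i ∧ x i < 1) (hξ : 0 < ξ)
    (hξα : ξ ≤ (α : ℝ)) :
    ∑ U : Fin k → Fin (m + 2), ∑ V : Fin l → Fin (m + 2),
        (μ (op a (opV b (wZ V * wZ U))) : ℝ) * (Vt V y ξ η * Ht U x ξ 0) =
      ∑ U : Fin k → Fin (m + 2), ∑ V : Fin l → Fin (m + 2),
        (μ (op a (opV b (wZ V) * wZ U)) : ℝ) * (Vt V y ξ η * Ht U x ξ 0) := by
  obtain ⟨_, hop, hopV, _, _, _, _, _, _, _, _, _, _, _, _, _, _, _, _, _, _, _, _, _, hcentH, -⟩ := H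
  by_cases hb : b = ℓ'
  · -- the correction term vanishes after summation over `U`
    have key : ∀ V : Fin l → Fin (m + 2), ∑ U : Fin k → Fin (m + 2),
        (μ (op a (wZ V * (Zq ℓ' * wZ U - wZ U * Zq ℓ'))) : ℝ) * Ht U x ξ 0 = 0 := by
      intro V
      by_cases ha : a = ℓ
      · have e1 := hcentH μ (Zq ℓ * wZ V) 1 x ξ hx hξ hξα
        have e2 := hcentH μ (wZ V) (Zq ℓ) x ξ hx hξ hξα
        have hrw : ∀ U : Fin k → Fin (m + 2),
            (μ (op a (wZ V * (Zq ℓ' * wZ U - wZ U * Zq ℓ'))) : ℝ) * Ht U x ξ 0 =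
              (μ (Zq ℓ * wZ V * (Zq ℓ' * wZ U - wZ U * Zq ℓ') * 1) : ℝ) * Ht U x ξ 0 -
                (μ (wZ V * (Zq ℓ' * wZ U - wZ U * Zq ℓ') * Zq ℓ) : ℝ) * Ht U x ξ 0 := by
          intro U
          rw [hop, if_pos ha, ← sub_mul, ← Rat.cast_sub, ← map_sub]
          congr 3; noncomm_ring
        rw [Finset.sum_congr rfl fun U _ => hrw U, Finset.sum_sub_distrib, e1, e2, sub_zero]
      · have e1 := hcentH μ (Zq a * wZ V) 1 x ξ hx hξ hξα
        have hrw : ∀ U : Fin k → Fin (m + 2),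
            (μ (op a (wZ V * (Zq ℓ' * wZ U - wZ U * Zq ℓ'))) : ℝ) * Ht U x ξ 0 =
              (μ (Zq a * wZ V * (Zq ℓ' * wZ U - wZ U * Zq ℓ') * 1) : ℝ) * Ht U x ξ 0 := by
          intro U
          rw [hop, if_neg ha]
          congr 3; noncomm_ring
        rw [Finset.sum_congr rfl fun U _ => hrw U, e1]
    rw [← sub_eq_zero, ← Finset.sum_sub_distrib]
    have hrw : ∀ U : Fin k → Fin (m + 2),
        ∑ V : Fin l → Fin (m + 2), (μ (op a (opV b (wZ V * wZ U))) : ℝ) * (Vt V y ξ η * Ht U x ξ 0) -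
          ∑ V : Fin l → Fin (m + 2), (μ (op a (opV b (wZ V) * wZ U)) : ℝ) * (Vt V y ξ η * Ht U x ξ 0) =
        ∑ V : Fin l → Fin (m + 2), Vt V y ξ η *
          ((μ (op a (wZ V * (Zq ℓ' * wZ U - wZ U * Zq ℓ'))) : ℝ) * Ht U x ξ 0) := by
      intro U
      rw [← Finset.sum_sub_distrib]
      refine Finset.sum_congr rfl fun V _ => ?_
      rw [hopV, hopV, if_pos hb, if_pos hb, ← sub_mul, ← Rat.cast_sub, ← map_sub, ← map_sub]
      have : Zq ℓ' * (wZ V * wZ U) - wZ V * wZ U * Zq ℓ' - (Zq ℓ' * wZ V - wZ V * Zq ℓ') * wZ U =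
          wZ V * (Zq ℓ' * wZ U - wZ U * Zq ℓ') := by noncomm_ring
      rw [this]; ring
    rw [Finset.sum_congr rfl fun U _ => hrw U, Finset.sum_comm]
    refine Finset.sum_eq_zero fun V _ => ?_
    rw [← Finset.mul_sum, key, mul_zero]
  · refine Finset.sum_congr rfl fun U _ => Finset.sum_congr rfl fun V _ => ?_
    rw [hopV, hopV, if_neg hb, if_neg hb, mul_assoc]

include H in
/-- **Reverse peeling** (pure algebra from the peeling identity `hpeelV`; `β ≠ 0`, and Mathlib's
`1/0 = 0` covers `η = 0`):
`Σ_{V : l+1} μ(op_a(wZ V · X)) Vt_V(η/β :: y; ξ, β) = β Σ_b gd_b(ξ,η) Σ_{V : l} μ(op_a(opV_b(wZ V) · X)) Vt_V(y; ξ, η)`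
(the coefficient of `ℓ'` is `1/(η/β) = β gd_{ℓ'}(ξ,η)`). [cite: IharaKanekoZagier2006, Cor. 5] -/
theorem qe_peel_back (μ : (DrinfeldKohnoTrunc ℚ (Fin 4) N) →ₗ[ℚ] ℚ) {l : ℕ} (a : Fin (m + 2))
    (X : DrinfeldKohnoTrunc ℚ (Fin 4) N) (y : Fin l → ℝ) (ξ η : ℝ) (hβ : (β : ℝ) ≠ 0) :
    ∑ V : Fin (l + 1) → Fin (m + 2), (μ (op a (wZ V * X)) : ℝ) * Vt V (Fin.cons (η / β) y) ξ β =
      (β : ℝ) * ∑ b : Fin (m + 2), gd b ξ η *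
        ∑ V : Fin l → Fin (m + 2), (μ (op a (opV b (wZ V) * X)) : ℝ) * Vt V y ξ η := by
  obtain ⟨_, _, hopV, _, _, _, _, _, _, _, _, _, _, _, _, _, _, _, hgd_reg, _, _, _, hpeelV, -⟩ := H
  have hβt : (β : ℝ) * (η / β) = η := mul_div_cancel₀ η hβ
  have key := hpeelV ((μ ∘ₗ op a) ∘ₗ LinearMap.mulRight ℚ X) (η / β) y ξ β
  simp only [LinearMap.comp_apply, LinearMap.mulRight_apply, hβt] at key
  rw [key]
  symm
  rw [Finset.mul_sum]
  have hR : ∀ b : Fin (m + 2),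
      (β : ℝ) * (gd b ξ η * ∑ V : Fin l → Fin (m + 2), (μ (op a (opV b (wZ V) * X)) : ℝ) * Vt V y ξ η) =
        (if b = ℓ' then 1 / (η / β) else (β : ℝ) * gd b ξ η) *
            ∑ V : Fin l → Fin (m + 2), (μ (op a (Zq b * wZ V * X)) : ℝ) * Vt V y ξ η -
          (if b = ℓ' then (1 / (η / β)) *
            ∑ V : Fin l → Fin (m + 2), (μ (op a (wZ V * Zq ℓ' * X)) : ℝ) * Vt V y ξ η else 0) := by
    intro b
    by_cases hb : b = ℓ'
    · rw [if_pos hb, if_pos hb, hb, hgd_reg, one_div_div, ← mul_sub, ← Finset.sum_sub_distrib, ← mul_assoc,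
        mul_one_div]
      congr 1
      refine Finset.sum_congr rfl fun V _ => ?_
      rw [hopV, if_pos rfl, sub_mul, map_sub, map_sub, Rat.cast_sub, sub_mul]
    · rw [if_neg hb, if_neg hb, sub_zero, ← mul_assoc]
      congr 1
      refine Finset.sum_congr rfl fun V _ => ?_
      rw [hopV, if_neg hb]
  rw [Finset.sum_congr rfl fun b _ => hR b, Finset.sum_sub_distrib, Finset.sum_ite_eq']
  simp only [Finset.mem_univ, if_true]

include H in
/-- **The level-`(n−2)` sum is a transport one transverse degree up** (open horizontal cube,
`0 < ξ ≤ α`, `β ≠ 0`): `β Σ_b gd_b(ξ,η) B^{(μ∘op a)∘opV b}_{k,l}(x,y;ξ,η) = B^{μ∘op a}_{k,l+1}(x, η/β :: y; ξ, β)`.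
[cite: Drinfeld1991, §2] -/
theorem qe_sum_gd_Bf (μ : (DrinfeldKohnoTrunc ℚ (Fin 4) N) →ₗ[ℚ] ℚ) {k l : ℕ} (a : Fin (m + 2))
    (x : Fin k → ℝ) (y : Fin l → ℝ) (ξ η : ℝ) (hx : ∀ i, 0 < x i ∧ x i < 1) (hξ : 0 < ξ)
    (hξα : ξ ≤ (α : ℝ)) (hβ : (β : ℝ) ≠ 0) :
    (β : ℝ) * ∑ b : Fin (m + 2), gd b ξ η * Bf ((μ ∘ₗ op a) ∘ₗ opV b) x y ξ η =
      Bf (μ ∘ₗ op a) x (Fin.cons (η / β) y) ξ β := by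
  have h1 := fun b => qe_opV_inside H μ a b x y ξ η hx hξ hξα
  have h2 := fun X => qe_peel_back H μ a X y ξ η hβ
  obtain ⟨_, _, _, _, hBf, -⟩ := H
  simp only [hBf, LinearMap.comp_apply, h1]
  have h3 : ∀ U : Fin k → Fin (m + 2),
      ∑ V : Fin (l + 1) → Fin (m + 2), (μ (op a (wZ V * wZ U)) : ℝ) * (Vt V (Fin.cons (η / β) y) ξ β * Ht U x ξ 0) =
        ((β : ℝ) * ∑ b : Fin (m + 2), gd b ξ η *
          ∑ V : Fin l → Fin (m + 2), (μ (op a (opV b (wZ V) * wZ U)) : ℝ) * Vt V y ξ η) * Ht U x ξ 0 := by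
    intro U
    rw [← h2, Finset.sum_mul]
    exact Finset.sum_congr rfl fun V _ => by ring
  rw [Finset.sum_congr rfl fun U _ => h3 U]
  calc (β : ℝ) * ∑ b : Fin (m + 2), gd b ξ η * ∑ U : Fin k → Fin (m + 2), ∑ V : Fin l → Fin (m + 2),
          (μ (op a (opV b (wZ V) * wZ U)) : ℝ) * (Vt V y ξ η * Ht U x ξ 0)
      = ∑ b : Fin (m + 2), ∑ U : Fin k → Fin (m + 2), ∑ V : Fin l → Fin (m + 2),
          (β : ℝ) * gd b ξ η * (μ (op a (opV b (wZ V) * wZ U)) : ℝ) * Vt V y ξ η * Ht U x ξ 0 := by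
        rw [Finset.mul_sum]
        refine Finset.sum_congr rfl fun b _ => ?_
        rw [Finset.mul_sum, Finset.mul_sum]
        refine Finset.sum_congr rfl fun U _ => ?_
        rw [Finset.mul_sum, Finset.mul_sum]
        exact Finset.sum_congr rfl fun V _ => by ring
    _ = ∑ U : Fin k → Fin (m + 2), ∑ b : Fin (m + 2), ∑ V : Fin l → Fin (m + 2),
          (β : ℝ) * gd b ξ η * (μ (op a (opV b (wZ V) * wZ U)) : ℝ) * Vt V y ξ η * Ht U x ξ 0 :=
        Finset.sum_comm
    _ = _ := by
        refine Finset.sum_congr rfl fun U _ => ?_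
        rw [Finset.mul_sum, Finset.sum_mul]
        refine Finset.sum_congr rfl fun b _ => ?_
        rw [Finset.mul_sum, Finset.mul_sum, Finset.sum_mul]
        exact Finset.sum_congr rfl fun V _ => by ring

include H in
/-- In positive transverse length the transport `B` vanishes at height `0`. [folklore] -/
theorem qe_Bf_eta_zero (ν : (DrinfeldKohnoTrunc ℚ (Fin 4) N) →ₗ[ℚ] ℚ) {k l : ℕ} (x : Fin k → ℝ)
    (y : Fin (l + 1) → ℝ) (ξ : ℝ) : Bf ν x y ξ 0 = 0 := by
  obtain ⟨_, _, _, _, hBf, _, _, _, _, _, _, _, _, _, _, _, hVt_zero, -⟩ := H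
  rw [hBf]
  exact Finset.sum_eq_zero fun U _ => Finset.sum_eq_zero fun V _ => by rw [hVt_zero, zero_mul, mul_zero]

/-! ### Semialgebraicity of the integrands (worker QE) -/

/-- **Semialgebraic functions composed with coordinate projections are semialgebraic**
(substitution of coordinates). [cite: BochnakCosteRoy1998, Prop. 2.2.6] -/
theorem qe_comp_proj {n₁ n₂ : ℕ} (π : Fin n₁ → Fin n₂) {D : Set (Fin n₁ → ℝ)} {g : (Fin n₁ → ℝ) → ℝ}
    (hg : IsSemialgebraicFunOn ℚ D g) {S : Set (Fin n₂ → ℝ)} (hS : IsSemialgebraic ℚ S)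
    (hSD : ∀ z ∈ S, (fun i => z (π i)) ∈ D) :
    IsSemialgebraicFunOn ℚ S (fun z => g (fun i => z (π i))) := by
  rw [isSemialgebraicFunOn_iff] at hg ⊢
  let π' : Fin (n₁ + 1) → Fin (n₂ + 1) := Fin.lastCases (Fin.last n₂) (fun i => Fin.castSucc (π i))
  convert hS.setOf_init_mem.inter (hg.preimage_comp π') using 1
  ext v
  have h1 : Fin.init (v ∘ π') = fun i => Fin.init v (π i) := by ext i; simp [π', Fin.init]
  have h2 : (v ∘ π') (Fin.last n₁) = v (Fin.last n₂) := by simp [π']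
  simp only [mem_setOf_eq, mem_inter_iff, mem_preimage, h1, h2]
  exact ⟨fun h => ⟨h.1, hSD _ h.1, h.2⟩, fun h => ⟨h.1, h.2.2⟩⟩

include H in
/-- **The transport `B` composed with semialgebraic blocks and roles is semialgebraic.**
[cite: BochnakCosteRoy1998, Prop. 2.2.6] -/
theorem qe_sa_Bf {d : ℕ} {W : Set (Fin d → ℝ)} (hW : IsSemialgebraic ℚ W)
    (ν : (DrinfeldKohnoTrunc ℚ (Fin 4) N) →ₗ[ℚ] ℚ) {k l : ℕ}
    {X : (Fin d → ℝ) → Fin k → ℝ} {Y : (Fin d → ℝ) → Fin l → ℝ} {P Q : (Fin d → ℝ) → ℝ}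
    (hX : ∀ i, IsSemialgebraicFunOn ℚ W fun z => X z i) (hY : ∀ j, IsSemialgebraicFunOn ℚ W fun z => Y z j)
    (hP : IsSemialgebraicFunOn ℚ W P) (hQ : IsSemialgebraicFunOn ℚ W Q) :
    IsSemialgebraicFunOn ℚ W fun z => Bf ν (X z) (Y z) (P z) (Q z) := by
  obtain ⟨_, _, _, _, hBf, _, _, _, _, _, _, _, _, _, _, _, _, _, _, _, _, _, _, _, _, _, _, _, _, _, _, _, _,
    _, _, _, _, _, _, _, hsa_Ht, hsa_Vt, -⟩ := H
  have h0 : IsSemialgebraicFunOn ℚ W fun _ => (0 : ℝ) :=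
    (isSemialgebraicFunOn_const_ratCast hW 0).congr fun _ _ => Rat.cast_zero
  refine (IsSemialgebraicFunOn.fun_finsetSum Finset.univ hW fun U _ =>
    IsSemialgebraicFunOn.fun_finsetSum Finset.univ hW fun V _ =>
      (isSemialgebraicFunOn_const_ratCast hW (ν (wZ V * wZ U))).fun_mul
        ((hsa_Vt hW V hY hP hQ).fun_mul (hsa_Ht hW U hX hP h0))).congr fun z _ => ?_
  rw [hBf]

include H in
/-- **The coordinate blocks are semialgebraic**, and so is any semialgebraic function of a
sub-block of the parameters. [cite: BochnakCosteRoy1998, Prop. 2.2.6] -/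
theorem qe_sa_blocks (k l e : ℕ) :
    (∀ i, IsSemialgebraicFunOn ℚ (KZ.cube (k + l + e)) fun w => Xb k l e w i) ∧
    (∀ j, IsSemialgebraicFunOn ℚ (KZ.cube (k + l + e)) fun w => Yb k l e w j) ∧
    (∀ s, IsSemialgebraicFunOn ℚ (KZ.cube (k + l + e)) fun w => Θb k l e w s) ∧
    (∀ {e' : ℕ} (π : Fin e' → Fin e) (g : (Fin e' → ℝ) → ℝ), IsSemialgebraicFunOn ℚ (KZ.cube e') g →
      IsSemialgebraicFunOn ℚ (KZ.cube (k + l + e)) fun w => g (fun i => Θb k l e w (π i))) := by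
  obtain ⟨_, _, _, _, _, _, _, _, hXb, hYb, hΘb, -⟩ := H
  have hW := KZ.isSemialgebraic_cube (n := k + l + e)
  have hc : ∀ i : Fin (k + l + e), IsSemialgebraicFunOn ℚ (KZ.cube (k + l + e)) fun w => w i := fun i =>
    (isSemialgebraicFunOn_aeval hW (MvPolynomial.X i : MvPolynomial (Fin (k + l + e)) ℚ)).congr
      fun z _ => by simp
  refine ⟨fun i => ?_, fun j => ?_, fun s => ?_, fun π g hg => ?_⟩
  · exact (hc (Fin.castAdd e (Fin.castAdd l i))).congr fun w _ => by rw [hXb]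
  · exact (hc (Fin.castAdd e (Fin.natAdd k j))).congr fun w _ => by rw [hYb]
  · exact (hc (Fin.natAdd (k + l) s)).congr fun w _ => by rw [hΘb]
  · refine (qe_comp_proj (fun i => Fin.natAdd (k + l) (π i)) hg hW fun w hw => ?_).congr
      fun w _ => by simp only [hΘb]
    rw [KZ.mem_cube] at hw ⊢
    exact fun i => hw _


end AbstractEngine

/-- **Hook `cornerEngineQE_comp_cube`** (registered form of `qe_comp_proj` between cubes): a semialgebraic
function of a sub-block of the coordinates of a cube point is semialgebraic on the big cube.
[cite: BochnakCosteRoy1998, Prop. 2.2.6] -/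
theorem cornerEngineQE_comp_cube : ∀ (d e e' : ℕ) (ι : Fin e → Fin d) (π : Fin e' → Fin e) (g : (Fin e' → ℝ) → ℝ), IsSemialgebraicFunOn ℚ (KZ.cube e') g → IsSemialgebraicFunOn ℚ (KZ.cube d) fun w => g (fun i => w (ι (π i))) :=
  fun _ _ _ ι π _ hg => qe_comp_proj (fun i => ι (π i)) hg KZ.isSemialgebraic_cube fun _ hw =>
    KZ.mem_cube.2 fun _ => (KZ.mem_cube.1 hw) _

end Summit.KontsevichZagierPeriods.FurushoPentagon.PentagonInKZ
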